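import Summits.BirchSwinnertonDyer.BirchSwinnertonDyer.Theorems.Rank2ObservatoryQuadField769Places
import HarnessLib

/-!
# BirchSwinnertonDyer — rank ≥ 2 observatory: the split place `17` of `ℚ(√769)` (ℤ/2-torsion row `392190k1`)

HONEST FRAMING: per-curve certified theorems and census instruments; no claim on BSD in rank ≥ 2.

Row-independent data of the successor instrument KERNEL-2DESC-Z2 at the prime `17`, which splits in
`K = ℚ(ω)`, `ω² = ω + 192` (`…QuadField769`): the two residue maps `𝓞 K → ℤ/17` (`ω ↦ 10`, `ω ↦ 8`),
the generators `π₁₇ = −107 − 8ω`, `π₁₇' = −115 + 8ω` of norm `17` with `17 = π₁₇ π₁₇'`, the two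
`SplitPrime` packages `P17a`, `P17b` (`…Z2SplitOdd`) with kernel certificates, their residue formulas on
`MonicQuad.lin`, and the correction bits `c = qrOf (res π') = 0` at both (`res π' = 16 = 4²`). Used by the
refined odd clause (`…Z2OddCaseRefined.oddClauseR_sound`) of the row file `392190k1`, whose cover count needs
the places `{∞, 2, 3, 5, 17}` (the instance `Fact (Nat.Prime 17)` is `QuadField769.fact_prime_17`). Sorry-free; axioms `propext`, `Classical.choice`, `Quot.sound`.
[cite: Cassels1991LecturesEllipticCurves, §15]
-/

-- single-conjunct summit: `Summit.BirchSwinnertonDyer.BirchSwinnertonDyer.…` repeats the name by design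
set_option linter.dupNamespace false

noncomputable section

open scoped NumberField

open Polynomial Module NumberField

namespace Summit.BirchSwinnertonDyer.BirchSwinnertonDyer.Rank2Observatory.TwoDescZ2

namespace QuadField769

/-! ## Residue maps at `17` -/

/-- A ring hom `ψ : 𝓞 K →+* ZMod 17` with `ψ θ = 10` exists (`10` is a root of the minimal polynomial of `θ` mod `17`). [folklore] -/
theorem exists_psi17_10 : ∃ ψ : 𝓞 (QuadField (-1) (-192)) →+* ZMod 17, ψ (MonicQuad.thetaInt aeval_ω) = 10 :=
  MonicQuad.exists_ringHom_of_root irreducible aeval_ω finrank_eq hsq (10 : ZMod 17) (by decide)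

/-- `res₁₇ᵃ : ω ↦ 10 (mod 17)`. -/
def res17a : 𝓞 (QuadField (-1) (-192)) →+* ZMod 17 := exists_psi17_10.choose
/-- The residue map `res17a` at `θ` (its defining property, by `choose_spec`). [folklore] -/
theorem res17a_ω : res17a (MonicQuad.thetaInt aeval_ω) = 10 := exists_psi17_10.choose_spec
/-- `res₁₇ᵇ : ω ↦ 8 (mod 17)`. -/
def res17b : 𝓞 (QuadField (-1) (-192)) →+* ZMod 17 := exists_psi17.choose
/-- The residue map `res17b` at `θ` (its defining property, by `choose_spec`). [folklore] -/
theorem res17b_ω : res17b (MonicQuad.thetaInt aeval_ω) = 8 := exists_psi17.choose_spec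

/-! ## Generators at `17` -/

/-- `π₁₇ = −107 − 8ω` (norm `17`, `ω ≡ 10`). -/
def g17a : 𝓞 (QuadField (-1) (-192)) := MonicQuad.lin aeval_ω (-107) (-8)
/-- `π₁₇' = −115 + 8ω` (norm `17`, `ω ≡ 8`). -/
def g17b : 𝓞 (QuadField (-1) (-192)) := MonicQuad.lin aeval_ω (-115) 8

/-- The place generator `g17a` is prime in `𝓞 K` (prime-norm certificate via `MonicQuad.lin_prime_of_prime`). [folklore] -/
theorem g17a_prime : Prime g17a :=
  MonicQuad.lin_prime_of_prime irreducible aeval_ω finrank_eq (-107) (-8) (n := 17)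
    (by norm_num [MonicQuad.normForm]) (by norm_num)
/-- The place generator `g17b` is prime in `𝓞 K` (prime-norm certificate via `MonicQuad.lin_prime_of_prime`). [folklore] -/
theorem g17b_prime : Prime g17b :=
  MonicQuad.lin_prime_of_prime irreducible aeval_ω finrank_eq (-115) 8 (n := 17)
    (by norm_num [MonicQuad.normForm]) (by norm_num)

/-- `17 = π₁₇ π₁₇'`. -/
theorem seventeen_eq : ((17 : ℕ) : 𝓞 (QuadField (-1) (-192))) = g17a * g17b := by
  simp only [g17a, g17b, MonicQuad.lin]
  push_cast
  linear_combination (64 : 𝓞 (QuadField (-1) (-192))) * ωi_rel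

/-! ## Split data at `17` -/

/-- The prime `(17, ω − 10)`: `π = −107 − 8ω`, `π' = −115 + 8ω`, residue map `ω ↦ 10`. -/
def P17a : SplitPrime (𝓞 (QuadField (-1) (-192))) 17 where
  π := g17a
  π' := g17b
  res := res17a
  hℓ := seventeen_eq
  hπ := by rw [g17a, MonicQuad.map_lin aeval_ω _ res17a_ω]; decide
  hπ' := by rw [g17b, MonicQuad.map_lin aeval_ω _ res17a_ω]; decide
  hker := dvd_of_res_eq_zero res17a g17a_prime (by rw [g17a, MonicQuad.map_lin aeval_ω _ res17a_ω]; decide)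

/-- The prime `(17, ω − 8)`: `π = −115 + 8ω`, `π' = −107 − 8ω`, residue map `ω ↦ 8`. -/
def P17b : SplitPrime (𝓞 (QuadField (-1) (-192))) 17 where
  π := g17b
  π' := g17a
  res := res17b
  hℓ := by rw [mul_comm]; exact seventeen_eq
  hπ := by rw [g17b, MonicQuad.map_lin aeval_ω _ res17b_ω]; decide
  hπ' := by rw [g17a, MonicQuad.map_lin aeval_ω _ res17b_ω]; decide
  hker := dvd_of_res_eq_zero res17b g17b_prime (by rw [g17b, MonicQuad.map_lin aeval_ω _ res17b_ω]; decide)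

/-- The residue map of the split-prime datum `P17a` at `θ`. [folklore] -/
theorem P17a_res_theta : P17a.res (MonicQuad.thetaInt aeval_ω) = 10 := res17a_ω
/-- The residue map of the split-prime datum `P17b` at `θ`. [folklore] -/
theorem P17b_res_theta : P17b.res (MonicQuad.thetaInt aeval_ω) = 8 := res17b_ω
/-- The residue map of the split-prime datum `P17a` on `p + qθ`. [folklore] -/
theorem P17a_res_lin (p q : ℤ) : P17a.res (MonicQuad.lin aeval_ω p q) = (p : ZMod 17) + (q : ZMod 17) * 10 :=
  MonicQuad.map_lin aeval_ω _ res17a_ω p q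
/-- The residue map of the split-prime datum `P17b` on `p + qθ`. [folklore] -/
theorem P17b_res_lin (p q : ℤ) : P17b.res (MonicQuad.lin aeval_ω p q) = (p : ZMod 17) + (q : ZMod 17) * 8 :=
  MonicQuad.map_lin aeval_ω _ res17b_ω p q
/-- Correction bit at `(17, ω − 10)`: `res π' = −115 + 8·10 ≡ 16 = 4²`, a square. -/
theorem P17a_c : qrOf (P17a.res P17a.π') = 0 := by
  rw [qrOf_eq_sqb, show P17a.res P17a.π' = 16 by
    rw [show P17a.π' = g17b from rfl, g17b, P17a_res_lin]; decide]
  decide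
/-- Correction bit at `(17, ω − 8)`: `res π' = −107 − 8·8 ≡ 16 = 4²`, a square. -/
theorem P17b_c : qrOf (P17b.res P17b.π') = 0 := by
  rw [qrOf_eq_sqb, show P17b.res P17b.π' = 16 by
    rw [show P17b.π' = g17a from rfl, g17a, P17b_res_lin]; decide]
  decide

end QuadField769

end Summit.BirchSwinnertonDyer.BirchSwinnertonDyer.Rank2Observatory.TwoDescZ2

end
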